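import Summits.MatrixMultiplication.MatrixMultiplication.Theorems.ObstructionDescentUniversalOccurrenceTwoRectanglePairAlphabet

set_option linter.dupNamespace false
set_option autoImplicit false

/-!
# Universal occurrence — two rectangles and TWO COLUMN PAIRS, part C: `((2^N),(2^N),(2N-6,4,2))` (decomp-mm · lens 3 · gen 43)

Route `route-MatrixMultiplication-ObstructionDescent` (sub-problem `MatrixMultiplication`, `ω(ℂ) = 2`); SUPPORT for the crux
`NoOccurrenceObstruction` (`P_O`, item `stmt-MatrixMultiplication-29040`) through the universal-occurrence programme (NODE-g29…g43
of the decomp-mm cell, lens 3).  Nothing here proves `ω = 2` or closes an item; no `def`, no `sorry`, standard axioms.  Closure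
currency as in parts I–IX: "the triple `(λ⁰,λ¹,λ²)` occurs for `s`" is `isotypicSum₁ λ⁰ (isotypicSum₂ λ¹ (isotypicSum₃ λ² (s^{⊗d}))) ≠ 0`.

**This file.**  `occurs_unitTensor_twoRectangle_fourTwo`: for all `m ≥ N ≥ 5` the three-row NON-hook type `((2^N),(2^N),(2N-6,4,2))`
occurs for `⟨m⟩`, uniformly in `N` (outside the Chow sector and the hook series).  Certificate (floor law of part IX, twist identity of the
hook series, pair tableau and local alphabet of parts A, B): `M = e_T`, `T` the pair tableau; colouring `g = (0,1,2,0,1,0,0,…)`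
on the slots `s₀, s₁, …`; block structure `e = e_std ∘ (3 5)(8 9)`, i.e. core columns `[(0,s₀),(1,s₀),(0,s₁)] ‖ [(1,s₂),(0,s₂),(1,s₁)]`,
`[(0,s₃),(1,s₃)] ‖ [(1,s₄),(0,s₄)]`, arm `(q mod 2, q div 2)`, `q ≥ 10`; twist `H = {s₁}`.  Every valid term is `e_T(g ∘ w_σ)`; support,
validity at `s₁` and the colour counts leave twins and anti-twins only, all of value `+1`; `σ₀ = (s₁ s₂)`, `σ₁ = (s₀ s₁ s₂)(s₃ s₄)`
realises the row word.  Exact counts: floor-law sum `160, 1344, 20736` (`N = 5, 6, 7`); `14` configurations (`2` anti-twin), `N ≥ 6`.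

[cite: BurgisserIkenmeyer2011, §3.4 (Prop. 3.4), Thm. 4.4] [cite: BurgisserIkenmeyer2017, §5, Thm. 5.9 (proof of (2)), eq. (3.4)] [cite: Landsberg2017, §9.1.1]
-/

noncomputable section

open scoped BigOperators

namespace Summit.MatrixMultiplication.MatrixMultiplication.Theorems.ObstructionCalculus

open Literature.Computability.AlgebraicComplexity
open Literature.NumberTheory.DiophantineGeometry

/-! ### The certificate for `ν = (2N-6, 4, 2)` -/

set_option maxHeartbeats 400000 in
/-- **`((2^N),(2^N),(2N-6,4,2))` occurs for `⟨m⟩` for all `m ≥ N ≥ 5`** — a three-row non-hook type on the third leg, uniformly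
in `N`. [cite: BurgisserIkenmeyer2011, Thm. 4.4] [cite: BurgisserIkenmeyer2017, Thm. 5.9 (proof of (2))] -/
theorem occurs_unitTensor_twoRectangle_fourTwo {N m : ℕ} (hN : 5 ≤ N) (hNm : N ≤ m)
    {lam : Fin 3 → Nat.Partition (N * 2)} (h0 : lam 0 = Nat.Partition.rectangle N 2)
    (h1 : lam 1 = Nat.Partition.rectangle N 2) (h2 : (lam 2).sortedParts = [2 * N - 6, 4, 2]) :
    isotypicSum₁ (lam 0) (isotypicSum₂ (lam 1) (isotypicSum₃ (lam 2)
      (kroneckerPow (unitTensor ℂ m) (N * 2)))) ≠ 0 := by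
  classical
  -- the shape and the pair tableau `T`
  have hNY : ∀ x ∈ (lam 2).youngDiagram.cells, x.1 < N := fun x hx => by
    have := fst_lt_of_mem_youngDiagram_fourTwo (lam 2) h2 hx; omega
  have hd : (lam 2).youngDiagram.cells.card = N * 2 := Nat.Partition.card_cells_youngDiagram _
  obtain ⟨T, hT⟩ : ∃ T : StdFilling (N * 2) (lam 2).youngDiagram, ∀ p : Fin (N * 2), T.1 p =
      (if (p : ℕ) < 3 then ((p : ℕ), 0) else if (p : ℕ) < 6 then ((p : ℕ) - 3, 1)
        else if (p : ℕ) < 8 then ((p : ℕ) - 6, 2) else if (p : ℕ) < 10 then ((p : ℕ) - 8, 3) else (0, (p : ℕ) - 6)) :=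
    ⟨⟨fun p => if (p : ℕ) < 3 then ((p : ℕ), 0) else if (p : ℕ) < 6 then ((p : ℕ) - 3, 1)
        else if (p : ℕ) < 8 then ((p : ℕ) - 6, 2) else if (p : ℕ) < 10 then ((p : ℕ) - 8, 3) else (0, (p : ℕ) - 6),
      ⟨fun p => pairCell_mem_fourTwo hN (lam 2) h2 p p.2,
       fun p q hpq => Fin.ext (pairCell_injective hpq),
       fun p q hpq => pairCell_standard hpq⟩⟩, fun p => rfl⟩
  have hrowT : ∀ q : Fin (N * 2), (T.1 q).1 =
      if (q : ℕ) < 3 then (q : ℕ) else if (q : ℕ) < 6 then (q : ℕ) - 3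
      else if (q : ℕ) < 8 then (q : ℕ) - 6 else if (q : ℕ) < 10 then (q : ℕ) - 8 else 0 := fun q => by
    rw [hT]; split_ifs <;> rfl
  have hcolT : ∀ q : Fin (N * 2), (T.1 q).2 =
      if (q : ℕ) < 3 then 0 else if (q : ℕ) < 6 then 1
      else if (q : ℕ) < 8 then 2 else if (q : ℕ) < 10 then 3 else (q : ℕ) - 6 := fun q => by
    rw [hT]; split_ifs <;> rfl
  have hM : StdFilling.polytabloid ℂ hNY T ∈
      highestWeightSpace (wordRep ℂ N (N * 2)) (Weight.ofPartition N (lam 2)) := by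
    rw [← ydWeight_youngDiagram]; exact StdFilling.polytabloid_mem hNY T hd
  -- the slots, the positions and the block structures
  obtain ⟨s0, hs0⟩ : ∃ s : Fin N, (s : ℕ) = 0 := ⟨⟨0, by omega⟩, rfl⟩
  obtain ⟨s1, hs1⟩ : ∃ s : Fin N, (s : ℕ) = 1 := ⟨⟨1, by omega⟩, rfl⟩
  obtain ⟨s2, hs2⟩ : ∃ s : Fin N, (s : ℕ) = 2 := ⟨⟨2, by omega⟩, rfl⟩
  obtain ⟨s3, hs3⟩ : ∃ s : Fin N, (s : ℕ) = 3 := ⟨⟨3, by omega⟩, rfl⟩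
  obtain ⟨s4, hs4⟩ : ∃ s : Fin N, (s : ℕ) = 4 := ⟨⟨4, by omega⟩, rfl⟩
  obtain ⟨p3, hp3⟩ : ∃ p : Fin (N * 2), (p : ℕ) = 3 := ⟨⟨3, by omega⟩, rfl⟩
  obtain ⟨p4, hp4⟩ : ∃ p : Fin (N * 2), (p : ℕ) = 4 := ⟨⟨4, by omega⟩, rfl⟩
  obtain ⟨p5, hp5⟩ : ∃ p : Fin (N * 2), (p : ℕ) = 5 := ⟨⟨5, by omega⟩, rfl⟩
  obtain ⟨p8, hp8⟩ : ∃ p : Fin (N * 2), (p : ℕ) = 8 := ⟨⟨8, by omega⟩, rfl⟩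
  obtain ⟨p9, hp9⟩ : ∃ p : Fin (N * 2), (p : ℕ) = 9 := ⟨⟨9, by omega⟩, rfl⟩
  obtain ⟨ξ, hξ⟩ : ∃ ξ : Equiv.Perm (Fin (N * 2)), ξ = Equiv.swap p3 p5 * Equiv.swap p8 p9 := ⟨_, rfl⟩
  have hξv : ∀ q : Fin (N * 2), ((ξ q : Fin (N * 2)) : ℕ) =
      if (q : ℕ) = 3 then 5 else if (q : ℕ) = 5 then 3 else if (q : ℕ) = 8 then 9 else if (q : ℕ) = 9 then 8
      else (q : ℕ) := by
    intro q
    rw [hξ, Equiv.Perm.mul_apply, Equiv.swap_apply_def, Equiv.swap_apply_def]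
    simp only [Fin.ext_iff, hp3, hp5, hp8, hp9]
    split_ifs <;> omega
  obtain ⟨e, he⟩ : ∃ e : Fin (N * 2) ≃ Fin 2 × Fin N,
      e = ξ.trans (finProdFinEquiv.symm.trans (Equiv.prodComm (Fin N) (Fin 2))) := ⟨_, rfl⟩
  have hev : ∀ q : Fin (N * 2), (((e q).1 : Fin 2) : ℕ) = ((ξ q : Fin (N * 2)) : ℕ) % 2 ∧
      (((e q).2 : Fin N) : ℕ) = ((ξ q : Fin (N * 2)) : ℕ) / 2 := by
    intro q; rw [he]; simp [Fin.modNat, Fin.divNat]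
  obtain ⟨H, hH⟩ : ∃ H : Finset (Fin N), H = {s1} := ⟨_, rfl⟩
  have hHv : ∀ s : Fin N, s ∈ H ↔ (s : ℕ) = 1 := by
    intro s; rw [hH, Finset.mem_singleton, Fin.ext_iff, hs1]
  let F : Fin 2 × Fin N → Fin 2 × Fin N := fun x => (if x.2 ∈ H then Fin.rev x.1 else x.1, x.2)
  have hF : Function.Involutive F := by
    rintro ⟨a, s⟩; by_cases hs : s ∈ H <;> simp [F, hs, Fin.rev_rev]
  obtain ⟨e', he'⟩ : ∃ e' : Fin (N * 2) ≃ Fin 2 × Fin N,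
      ∀ q, e' q = (if (e q).2 ∈ H then Fin.rev (e q).1 else (e q).1, (e q).2) :=
    ⟨e.trans (Function.Involutive.toPerm F hF), fun q => rfl⟩
  -- the colouring `g = (0,1,2,0,1,0,0,…)`
  obtain ⟨g, hg⟩ : ∃ g : Fin N → Fin N, ∀ i, g i =
      if (i : ℕ) ≤ 2 then i else if (i : ℕ) = 4 then s1 else s0 := ⟨_, fun i => rfl⟩
  have hgv : ∀ i : Fin N, ((g i : Fin N) : ℕ) =
      if (i : ℕ) ≤ 2 then (i : ℕ) else if (i : ℕ) = 4 then 1 else 0 := by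
    intro i; rw [hg]; split_ifs <;> omega
  have hg2 : ∀ i : Fin N, ((g i : Fin N) : ℕ) = 2 → i = s2 := by
    intro i hi; have h := hgv i; rw [hi] at h; apply Fin.ext; split_ifs at h <;> omega
  have hgsum : ∑ i : Fin N, ((g i : Fin N) : ℕ) = 4 := by
    rw [sum_core_eq (fun i => ((g i : Fin N) : ℕ)) s0 s1 s2 s3 s4 hs0 hs1 hs2 hs3 hs4
      (fun s hs => by rw [hgv]; split_ifs <;> omega)]
    simp only [hgv, hs0, hs1, hs2, hs3, hs4]
    norm_num
  -- evaluation of the words `g ∘ w_σ` at the positions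
  have hpos : ∀ (σ : Fin 2 → Equiv.Perm (Fin N)) (n : ℕ) (hn : n < N * 2) (a : Fin 2) (s : Fin N),
      (if n = 3 then 5 else if n = 5 then 3 else if n = 8 then 9 else if n = 9 then 8 else n) % 2 = (a : ℕ) →
      (if n = 3 then 5 else if n = 5 then 3 else if n = 8 then 9 else if n = 9 then 8 else n) / 2 = (s : ℕ) →
      (g ∘ fun q => σ (e q).1 (e q).2) ⟨n, hn⟩ = g (σ a s) := by
    intro σ n hn a s ha hs
    obtain ⟨h1, h2⟩ := hev ⟨n, hn⟩
    rw [hξv] at h1 h2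
    dsimp only at h1 h2
    have ha' : (e ⟨n, hn⟩).1 = a := Fin.ext (by rw [h1, ha])
    have hs' : (e ⟨n, hn⟩).2 = s := Fin.ext (by rw [h2, hs])
    show g (σ (e ⟨n, hn⟩).1 (e ⟨n, hn⟩).2) = _
    rw [ha', hs']
  -- THE HEART: a valid term with `e_T(g ∘ w_σ) ≠ 0` is a twin or an anti-twin configuration, hence `e_T(g ∘ w_σ) = 1`
  have hVAL : ∀ σ : Fin 2 → Equiv.Perm (Fin N), (∀ s, (σ 0)⁻¹ (σ 1 s) ∈ H ↔ s ∈ H) →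
      StdFilling.polytabloid ℂ hNY T (g ∘ fun q => σ (e q).1 (e q).2) ≠ 0 →
      StdFilling.polytabloid ℂ hNY T (g ∘ fun q => σ (e q).1 (e q).2) = 1 := by
    intro σ hval hz
    obtain ⟨harm, hlt3, hlt2, hinj⟩ := pairTableau_support hNY T hT hz
    have hi0 : ∀ x, σ 0 ((σ 0)⁻¹ x) = x := fun x => (σ 0).apply_symm_apply x
    have u0 := hpos σ 0 (by omega) 0 s0 (by norm_num) (by norm_num [hs0])
    have u1 := hpos σ 1 (by omega) 1 s0 (by norm_num) (by norm_num [hs0])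
    have u2 := hpos σ 2 (by omega) 0 s1 (by norm_num) (by norm_num [hs1])
    have u3 := hpos σ 3 (by omega) 1 s2 (by norm_num) (by norm_num [hs2])
    have u4 := hpos σ 4 (by omega) 0 s2 (by norm_num) (by norm_num [hs2])
    have u5 := hpos σ 5 (by omega) 1 s1 (by norm_num) (by norm_num [hs1])
    have u6 := hpos σ 6 (by omega) 0 s3 (by norm_num) (by norm_num [hs3])
    have u7 := hpos σ 7 (by omega) 1 s3 (by norm_num) (by norm_num [hs3])
    have u8 := hpos σ 8 (by omega) 1 s4 (by norm_num) (by norm_num [hs4])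
    have u9 := hpos σ 9 (by omega) 0 s4 (by norm_num) (by norm_num [hs4])
    have harm0 : ∀ s : Fin N, 5 ≤ (s : ℕ) → ((g (σ 0 s) : Fin N) : ℕ) = 0 := by
      intro s hs
      have h := hpos σ (2 * s) (by omega) 0 s (by split_ifs <;> omega) (by split_ifs <;> omega)
      rw [← h]; exact harm _ (by simp; omega)
    have harm1 : ∀ s : Fin N, 5 ≤ (s : ℕ) → ((g (σ 1 s) : Fin N) : ℕ) = 0 := by
      intro s hs
      have h := hpos σ (2 * s + 1) (by omega) 1 s (by split_ifs <;> omega) (by split_ifs <;> omega)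
      rw [← h]; exact harm _ (by simp; omega)
    have bA0 : ((g (σ 0 s0) : Fin N) : ℕ) < 3 := by rw [← u0]; exact hlt3 _ (by norm_num)
    have bB0 : ((g (σ 1 s0) : Fin N) : ℕ) < 3 := by rw [← u1]; exact hlt3 _ (by norm_num)
    have bA1 : ((g (σ 0 s1) : Fin N) : ℕ) < 3 := by rw [← u2]; exact hlt3 _ (by norm_num)
    have bB2 : ((g (σ 1 s2) : Fin N) : ℕ) < 3 := by rw [← u3]; exact hlt3 _ (by norm_num)
    have bA2 : ((g (σ 0 s2) : Fin N) : ℕ) < 3 := by rw [← u4]; exact hlt3 _ (by norm_num)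
    have bB1 : ((g (σ 1 s1) : Fin N) : ℕ) < 3 := by rw [← u5]; exact hlt3 _ (by norm_num)
    have bA3 : ((g (σ 0 s3) : Fin N) : ℕ) < 2 := by rw [← u6]; exact hlt2 _ (by norm_num) (by norm_num)
    have bB3 : ((g (σ 1 s3) : Fin N) : ℕ) < 2 := by rw [← u7]; exact hlt2 _ (by norm_num) (by norm_num)
    have bB4 : ((g (σ 1 s4) : Fin N) : ℕ) < 2 := by rw [← u8]; exact hlt2 _ (by norm_num) (by norm_num)
    have bA4 : ((g (σ 0 s4) : Fin N) : ℕ) < 2 := by rw [← u9]; exact hlt2 _ (by norm_num) (by norm_num)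
    have cne : ∀ (i j : ℕ) (hi : i < N * 2) (hj : j < N * 2), i ≠ j → (T.1 ⟨i, hi⟩).2 = (T.1 ⟨j, hj⟩).2 →
        ∀ x y : Fin N, (g ∘ fun q => σ (e q).1 (e q).2) ⟨i, hi⟩ = x → (g ∘ fun q => σ (e q).1 (e q).2) ⟨j, hj⟩ = y →
        ((x : Fin N) : ℕ) ≠ ((y : Fin N) : ℕ) := by
      intro i j hi hj hij hc x y hx hy hxy
      have := hinj ⟨i, hi⟩ ⟨j, hj⟩ hc (by rw [hx, hy]; exact Fin.ext hxy)
      simp only [Fin.mk.injEq] at this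
      exact hij this
    have c34 := cne 3 4 (by omega) (by omega) (by norm_num) (by rw [hcolT, hcolT]; norm_num) _ _ u3 u4
    have c35 := cne 3 5 (by omega) (by omega) (by norm_num) (by rw [hcolT, hcolT]; norm_num) _ _ u3 u5
    have c45 := cne 4 5 (by omega) (by omega) (by norm_num) (by rw [hcolT, hcolT]; norm_num) _ _ u4 u5
    have c67 := cne 6 7 (by omega) (by omega) (by norm_num) (by rw [hcolT, hcolT]; norm_num) _ _ u6 u7
    have c89 := cne 8 9 (by omega) (by omega) (by norm_num) (by rw [hcolT, hcolT]; norm_num) _ _ u8 u9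
    have hvH : ((g (σ 1 s1) : Fin N) : ℕ) = ((g (σ 0 s1) : Fin N) : ℕ) := by
      set t := (σ 0)⁻¹ (σ 1 s1) with ht
      have htH : t ∈ H := (hval s1).2 (by rw [hHv]; exact hs1)
      have hts : σ 1 s1 = σ 0 t := by rw [ht, hi0]
      rw [hHv] at htH
      rw [hts, show t = s1 from Fin.ext (htH.trans hs1.symm)]
    have hsA : ((g (σ 0 s0) : Fin N) : ℕ) + ((g (σ 0 s1) : Fin N) : ℕ) + ((g (σ 0 s2) : Fin N) : ℕ) +
        ((g (σ 0 s3) : Fin N) : ℕ) + ((g (σ 0 s4) : Fin N) : ℕ) = 4 := by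
      rw [← sum_core_eq (fun s => ((g (σ 0 s) : Fin N) : ℕ)) s0 s1 s2 s3 s4 hs0 hs1 hs2 hs3 hs4 harm0,
        Equiv.sum_comp (σ 0) (fun x => ((g x : Fin N) : ℕ)), hgsum]
    have hsB : ((g (σ 1 s0) : Fin N) : ℕ) + ((g (σ 1 s1) : Fin N) : ℕ) + ((g (σ 1 s2) : Fin N) : ℕ) +
        ((g (σ 1 s3) : Fin N) : ℕ) + ((g (σ 1 s4) : Fin N) : ℕ) = 4 := by
      rw [← sum_core_eq (fun s => ((g (σ 1 s) : Fin N) : ℕ)) s0 s1 s2 s3 s4 hs0 hs1 hs2 hs3 hs4 harm1,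
        Equiv.sum_comp (σ 1) (fun x => ((g x : Fin N) : ℕ)), hgsum]
    have h2blk : ∀ a : Fin 2, (∀ s : Fin N, 5 ≤ (s : ℕ) → ((g (σ a s) : Fin N) : ℕ) = 0) →
        ((g (σ a s3) : Fin N) : ℕ) < 2 → ((g (σ a s4) : Fin N) : ℕ) < 2 →
        (((g (σ a s0) : Fin N) : ℕ) = 2 ∨ ((g (σ a s1) : Fin N) : ℕ) = 2 ∨ ((g (σ a s2) : Fin N) : ℕ) = 2) := by
      intro a harma b3 b4
      set t := (σ a)⁻¹ s2 with ht
      have hts : σ a t = s2 := (σ a).apply_symm_apply s2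
      have h2t : ((g (σ a t) : Fin N) : ℕ) = 2 := by rw [hts, hgv, if_pos (by omega), hs2]
      have ht5 : (t : ℕ) < 5 := by
        by_contra h; have := harma t (by omega); omega
      have ht3 : (t : ℕ) ≠ 3 := fun h => by rw [show t = s3 from Fin.ext (h.trans hs3.symm)] at h2t; omega
      have ht4 : (t : ℕ) ≠ 4 := fun h => by rw [show t = s4 from Fin.ext (h.trans hs4.symm)] at h2t; omega
      rcases (show (t : ℕ) = 0 ∨ (t : ℕ) = 1 ∨ (t : ℕ) = 2 by omega) with h | h | h
      · left; rwa [show t = s0 from Fin.ext (h.trans hs0.symm)] at h2t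
      · right; left; rwa [show t = s1 from Fin.ext (h.trans hs1.symm)] at h2t
      · right; right; rwa [show t = s2 from Fin.ext (h.trans hs2.symm)] at h2t
    have h2A := h2blk 0 harm0 bA3 bA4
    have h2B := h2blk 1 harm1 bB3 bB4
    have hx : ∀ (a : Fin 2) (s s' : Fin N), (s : ℕ) ≠ (s' : ℕ) → ((g (σ a s) : Fin N) : ℕ) < 3 →
        ((g (σ a s') : Fin N) : ℕ) < 3 → ((g (σ a s) : Fin N) : ℕ) + ((g (σ a s') : Fin N) : ℕ) ≤ 3 := by
      intro a s s' hne hs hs'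
      by_contra hc
      have h1 : ((g (σ a s) : Fin N) : ℕ) = 2 := by omega
      have h2 : ((g (σ a s') : Fin N) : ℕ) = 2 := by omega
      have := (σ a).injective ((hg2 _ h1).trans (hg2 _ h2).symm)
      exact hne (congrArg Fin.val this)
    have halt := twoPairs_local_configurations _ _ _ _ _ _ _ _ _ _ bA0 bB0 bA1 bB2 bA2 bB3 bB4 c34 c35 c45
      (by omega) (by omega) hvH hsA hsB h2A h2B
      (hx 0 s0 s1 (by omega) bA0 bA1) (hx 0 s0 s2 (by omega) bA0 bA2) (hx 0 s1 s2 (by omega) bA1 bA2)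
      (hx 1 s0 s1 (by omega) bB0 bB1) (hx 1 s0 s2 (by omega) bB0 bB2) (hx 1 s1 s2 (by omega) bB1 bB2)
    have hlt0 : ∀ p : Fin (N * 2), (p : ℕ) < 3 → (((g ∘ fun q => σ (e q).1 (e q).2) p : Fin N) : ℕ) < 3 :=
      fun p hp => hlt3 p (by omega)
    have hinj0 : ∀ p q : Fin (N * 2), (p : ℕ) < 3 → (q : ℕ) < 3 →
        (g ∘ fun q => σ (e q).1 (e q).2) p = (g ∘ fun q => σ (e q).1 (e q).2) q → p = q :=
      fun p q hp hq hpq => hinj p q (by rw [hcolT, hcolT, if_pos hp, if_pos hq]) hpq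
    have hlt2' : ∀ p : Fin (N * 2), 6 ≤ (p : ℕ) → (p : ℕ) < 8 →
        (((g ∘ fun q => σ (e q).1 (e q).2) p : Fin N) : ℕ) < 2 := fun p hp hp' => hlt2 p hp (by omega)
    have hinj2 : ∀ p q : Fin (N * 2), 6 ≤ (p : ℕ) → (p : ℕ) < 8 → 6 ≤ (q : ℕ) → (q : ℕ) < 8 →
        (g ∘ fun q => σ (e q).1 (e q).2) p = (g ∘ fun q => σ (e q).1 (e q).2) q → p = q :=
      fun p q hp hp' hq hq' hpq => hinj p q (by
        rw [hcolT, hcolT, if_neg (by omega), if_neg (by omega), if_pos hp', if_neg (by omega), if_neg (by omega),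
          if_pos hq']) hpq
    rcases halt with ⟨t3, t4, t8, t9⟩ | ⟨a4, a3, a9, a8⟩
    · -- twins
      apply pairTableau_twin_eq_one hNY T hT (by omega) harm hlt0 hinj0 hlt2' hinj2
      · intro p hp
        obtain ⟨n, hn⟩ := p
        dsimp only at hp ⊢
        rcases (show n = 0 ∨ n = 1 ∨ n = 2 by omega) with rfl | rfl | rfl
        · rw [u0]; exact u3.trans (Fin.ext t3)
        · rw [u1]; exact u4.trans (Fin.ext t4)
        · rw [u2]; exact u5.trans (Fin.ext hvH)
      · intro p hp hp'
        obtain ⟨n, hn⟩ := p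
        dsimp only at hp hp' ⊢
        rcases (show n = 6 ∨ n = 7 by omega) with rfl | rfl
        · rw [u6]; exact u8.trans (Fin.ext t8)
        · rw [u7]; exact u9.trans (Fin.ext t9)
    · -- anti-twins: an even column swap of a twin word
      rw [← pairTableau_evenSwap hNY T hT p3 p4 p8 p9 hp3 hp4 hp8 hp9]
      set v := (g ∘ fun q => σ (e q).1 (e q).2) with hv
      set q : Equiv.Perm (Fin (N * 2)) := Equiv.swap p3 p4 * Equiv.swap p8 p9 with hq
      have hqv : ∀ x : Fin (N * 2), ((q x : Fin (N * 2)) : ℕ) =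
          if (x : ℕ) = 3 then 4 else if (x : ℕ) = 4 then 3 else if (x : ℕ) = 8 then 9 else if (x : ℕ) = 9 then 8
          else (x : ℕ) := by
        intro x
        rw [hq, Equiv.Perm.mul_apply, Equiv.swap_apply_def, Equiv.swap_apply_def]
        simp only [Fin.ext_iff, hp3, hp4, hp8, hp9]
        split_ifs <;> omega
      have hqfix : ∀ x : Fin (N * 2), (x : ℕ) ≠ 3 → (x : ℕ) ≠ 4 → (x : ℕ) ≠ 8 → (x : ℕ) ≠ 9 → q x = x := by
        intro x h3 h4 h8 h9; apply Fin.ext; rw [hqv]; simp [h3, h4, h8, h9]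
      have hq3 : q ⟨3, by omega⟩ = ⟨4, by omega⟩ := Fin.ext (by rw [hqv]; simp)
      have hq4 : q ⟨4, by omega⟩ = ⟨3, by omega⟩ := Fin.ext (by rw [hqv]; simp)
      have hq8 : q ⟨8, by omega⟩ = ⟨9, by omega⟩ := Fin.ext (by rw [hqv]; simp)
      have hq9 : q ⟨9, by omega⟩ = ⟨8, by omega⟩ := Fin.ext (by rw [hqv]; simp)
      apply pairTableau_twin_eq_one hNY T hT (by omega)
      · intro p hp
        show (((v (q p)) : Fin N) : ℕ) = 0
        rw [hqfix p (by omega) (by omega) (by omega) (by omega)]; exact harm p hp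
      · intro p hp
        show (((v (q p)) : Fin N) : ℕ) < 3
        rw [hqfix p (by omega) (by omega) (by omega) (by omega)]; exact hlt0 p hp
      · intro p p' hp hp' hpp
        have h : v (q p) = v (q p') := hpp
        rw [hqfix p (by omega) (by omega) (by omega) (by omega),
          hqfix p' (by omega) (by omega) (by omega) (by omega)] at h
        exact hinj0 p p' hp hp' h
      · intro p hp hp'
        show (((v (q p)) : Fin N) : ℕ) < 2
        rw [hqfix p (by omega) (by omega) (by omega) (by omega)]; exact hlt2' p hp hp'
      · intro p p' hp₁ hp₂ hp'₁ hp'₂ hpp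
        have h : v (q p) = v (q p') := hpp
        rw [hqfix p (by omega) (by omega) (by omega) (by omega),
          hqfix p' (by omega) (by omega) (by omega) (by omega)] at h
        exact hinj2 p p' hp₁ hp₂ hp'₁ hp'₂ h
      · intro p hp
        show v (q _) = v (q p)
        rw [hqfix p (by omega) (by omega) (by omega) (by omega)]
        obtain ⟨n, hn⟩ := p
        dsimp only at hp ⊢
        rcases (show n = 0 ∨ n = 1 ∨ n = 2 by omega) with rfl | rfl | rfl
        · show v (q ⟨3, _⟩) = v ⟨0, _⟩
          rw [hq3, u4, u0]; exact Fin.ext a4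
        · show v (q ⟨4, _⟩) = v ⟨1, _⟩
          rw [hq4, u3, u1]; exact Fin.ext a3
        · show v (q ⟨5, _⟩) = v ⟨2, _⟩
          rw [hqfix _ (by norm_num) (by norm_num) (by norm_num) (by norm_num), u5, u2]; exact Fin.ext hvH
      · intro p hp hp'
        show v (q _) = v (q p)
        rw [hqfix p (by omega) (by omega) (by omega) (by omega)]
        obtain ⟨n, hn⟩ := p
        dsimp only at hp hp' ⊢
        rcases (show n = 6 ∨ n = 7 by omega) with rfl | rfl
        · show v (q ⟨8, _⟩) = v ⟨6, _⟩
          rw [hq8, u9, u6]; exact Fin.ext a9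
        · show v (q ⟨9, _⟩) = v ⟨7, _⟩
          rw [hq9, u8, u7]; exact Fin.ext a8
  -- the summands are `0` or `1`
  have hterm : ∀ σ : Fin 2 → Equiv.Perm (Fin N),
      (∏ a, ((Equiv.Perm.sign (σ a) : ℤ) : ℂ)) *
          (wordBlockSign ℂ e' (fun q => σ (e q).1 (e q).2) *
            ∑ w, StdFilling.polytabloid ℂ hNY T w *
              ∏ q, (fun i l : Fin N => if l = g i then (1 : ℂ) else 0) (σ (e q).1 (e q).2) (w q)) =
        if (∀ s, (σ 0)⁻¹ (σ 1 s) ∈ H ↔ s ∈ H) ∧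
            StdFilling.polytabloid ℂ hNY T (g ∘ fun q => σ (e q).1 (e q).2) ≠ 0 then 1 else 0 := by
    intro σ
    have hc : (∑ w, StdFilling.polytabloid ℂ hNY T w *
        ∏ q, (fun i l : Fin N => if l = g i then (1 : ℂ) else 0) (σ (e q).1 (e q).2) (w q)) =
        StdFilling.polytabloid ℂ hNY T (g ∘ fun q => σ (e q).1 (e q).2) :=
      sum_mul_prod_indicator_eq _ g _
    rw [hc, ← mul_assoc, sign_mul_wordBlockSign_twist e e' H he' σ]
    by_cases hval : ∀ s, (σ 0)⁻¹ (σ 1 s) ∈ H ↔ s ∈ H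
    · rw [if_pos hval, one_mul]
      by_cases hz : StdFilling.polytabloid ℂ hNY T (g ∘ fun q => σ (e q).1 (e q).2) = 0
      · rw [if_neg (fun h => h.2 hz), hz]
      · rw [if_pos ⟨hval, hz⟩]
        exact hVAL σ hval hz
    · rw [if_neg hval, zero_mul, if_neg (fun h => hval h.1)]
  refine occurs_unitTensor_twoRectangle_of_pairing_ne_zero hNm e e' h0 h1 hM
    (fun i l => if l = g i then (1 : ℂ) else 0) ?_
  intro hsum
  rw [Finset.sum_congr rfl (fun σ _ => hterm σ), Finset.sum_boole, Nat.cast_eq_zero,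
    Finset.card_eq_zero, Finset.filter_eq_empty_iff] at hsum
  -- the witness: `σ₀ = (s₁ s₂)`, `σ₁ = (s₀ s₁ s₂)(s₃ s₄)`, for which `g ∘ w_σ` is the row word of `T`
  obtain ⟨σw, hw0, hw1⟩ : ∃ σw : Fin 2 → Equiv.Perm (Fin N),
      σw 0 = Equiv.swap s1 s2 ∧ σw 1 = Equiv.swap s0 s1 * Equiv.swap s1 s2 * Equiv.swap s3 s4 :=
    ⟨![Equiv.swap s1 s2, Equiv.swap s0 s1 * Equiv.swap s1 s2 * Equiv.swap s3 s4], rfl, rfl⟩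
  apply hsum (Finset.mem_univ σw)
  have hsw0 : ∀ s : Fin N, ((σw 0 s : Fin N) : ℕ) =
      if (s : ℕ) = 1 then 2 else if (s : ℕ) = 2 then 1 else (s : ℕ) := by
    intro s
    rw [hw0, Equiv.swap_apply_def]
    simp only [Fin.ext_iff, hs1, hs2]
    split_ifs <;> omega
  have hsw1 : ∀ s : Fin N, ((σw 1 s : Fin N) : ℕ) =
      if (s : ℕ) = 0 then 1 else if (s : ℕ) = 1 then 2 else if (s : ℕ) = 2 then 0
      else if (s : ℕ) = 3 then 4 else if (s : ℕ) = 4 then 3 else (s : ℕ) := by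
    intro s
    rw [hw1, Equiv.Perm.mul_apply, Equiv.Perm.mul_apply, Equiv.swap_apply_def, Equiv.swap_apply_def,
      Equiv.swap_apply_def]
    simp only [Fin.ext_iff, hs0, hs1, hs2, hs3, hs4]
    split_ifs <;> omega
  constructor
  · -- validity
    intro s
    have hi0 : ∀ x, σw 0 ((σw 0)⁻¹ x) = x := fun x => (σw 0).apply_symm_apply x
    set t := (σw 0)⁻¹ (σw 1 s) with ht
    have h1 : ((σw 0 t : Fin N) : ℕ) = ((σw 1 s : Fin N) : ℕ) := by rw [ht, hi0]
    rw [hsw0, hsw1] at h1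
    rw [hHv, hHv]
    split_ifs at h1 <;> omega
  · -- `g ∘ w_σ = w_T`
    have hwrd : (g ∘ fun q => σw (e q).1 (e q).2) = StdFilling.rowWord hNY T := by
      funext q
      obtain ⟨n, hn⟩ := q
      apply Fin.ext
      show _ = (T.1 ⟨n, hn⟩).1
      rw [hrowT]
      dsimp only
      by_cases hn10 : n < 10
      · have hcases : n = 0 ∨ n = 1 ∨ n = 2 ∨ n = 3 ∨ n = 4 ∨ n = 5 ∨ n = 6 ∨ n = 7 ∨ n = 8 ∨ n = 9 := by omega
        rcases hcases with rfl | rfl | rfl | rfl | rfl | rfl | rfl | rfl | rfl | rfl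
        · rw [hpos σw 0 hn 0 s0 (by norm_num) (by norm_num [hs0]), hgv, hsw0]; simp [hs0]
        · rw [hpos σw 1 hn 1 s0 (by norm_num) (by norm_num [hs0]), hgv, hsw1]; simp [hs0]
        · rw [hpos σw 2 hn 0 s1 (by norm_num) (by norm_num [hs1]), hgv, hsw0]; simp [hs1]
        · rw [hpos σw 3 hn 1 s2 (by norm_num) (by norm_num [hs2]), hgv, hsw1]; simp [hs2]
        · rw [hpos σw 4 hn 0 s2 (by norm_num) (by norm_num [hs2]), hgv, hsw0]; simp [hs2]
        · rw [hpos σw 5 hn 1 s1 (by norm_num) (by norm_num [hs1]), hgv, hsw1]; simp [hs1]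
        · rw [hpos σw 6 hn 0 s3 (by norm_num) (by norm_num [hs3]), hgv, hsw0]; simp [hs3]
        · rw [hpos σw 7 hn 1 s3 (by norm_num) (by norm_num [hs3]), hgv, hsw1]; simp [hs3]
        · rw [hpos σw 8 hn 1 s4 (by norm_num) (by norm_num [hs4]), hgv, hsw1]; simp [hs4]
        · rw [hpos σw 9 hn 0 s4 (by norm_num) (by norm_num [hs4]), hgv, hsw0]; simp [hs4]
      · -- arm
        have ha : (if n = 3 then 5 else if n = 5 then 3 else if n = 8 then 9 else if n = 9 then 8 else n) % 2 =
            (((⟨n % 2, by omega⟩ : Fin 2) : Fin 2) : ℕ) := by dsimp only; split_ifs <;> omega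
        have hs : (if n = 3 then 5 else if n = 5 then 3 else if n = 8 then 9 else if n = 9 then 8 else n) / 2 =
            (((⟨n / 2, by omega⟩ : Fin N) : Fin N) : ℕ) := by dsimp only; split_ifs <;> omega
        rw [hpos σw n hn ⟨n % 2, by omega⟩ ⟨n / 2, by omega⟩ ha hs, hgv]
        have hfix : ((σw ⟨n % 2, by omega⟩ ⟨n / 2, by omega⟩ : Fin N) : ℕ) = n / 2 := by
          have : (⟨n % 2, by omega⟩ : Fin 2) = 0 ∨ (⟨n % 2, by omega⟩ : Fin 2) = 1 := by
            rcases Nat.mod_two_eq_zero_or_one n with h | h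
            · left; exact Fin.ext h
            · right; exact Fin.ext h
          rcases this with h | h
          · rw [h, hsw0]; dsimp only; split_ifs <;> omega
          · rw [h, hsw1]; dsimp only; split_ifs <;> omega
        rw [hfix]
        split_ifs <;> omega
    rw [hwrd, StdFilling.polytabloid_apply_rowWord]
    exact one_ne_zero

end Summit.MatrixMultiplication.MatrixMultiplication.Theorems.ObstructionCalculus
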